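import Mathlib
import Summits.PneNP.PneNP.Theses.WitnessForging

/-!
# Route WitnessForging — assembly item `Assembly` (stmt-PneNP-10554)

`Summit.PneNP.PneNP.Theses.WitnessForging.Assembly : SatBridge → ClassBridge → ForgingThesis →
PneNP` — the assembly X → PneNP of route WitnessForging, restated over listed items only.
It is the route file's deciding theorem
`Summit.PneNP.PneNP.Theses.WitnessForging.closes : ForgingThesis → SatBridge → ClassBridge → PneNP`
with its hypotheses reordered: if `¬PneNP` then every Cook-NP language is Cook-P; `ClassBridge`
turns this into `Nondeterministic.NP ⊆ BPP`; `SatBridge` at the constant polynomial `s = 3` yields a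
PPT algorithm within total variation `1/(3+1) = 1/4` of `μ_φ` on every satisfiable compact `φ`,
contradicting `ForgingThesis`.
-/

namespace Summit.PneNP.PneNP.Theorems

/-- **Assembly item of route WitnessForging** (stmt-PneNP-10554):
`SatBridge → ClassBridge → ForgingThesis → PneNP`, obtained from the route's deciding theorem
`Summit.PneNP.PneNP.Theses.WitnessForging.closes` by reordering its hypotheses.
[cite: JerrumValiantVazirani1986] [cite: CookClay2006, §1] -/
theorem witnessForging_assembly_proof : Summit.PneNP.PneNP.Theses.WitnessForging.Assembly := by
  unfold Summit.PneNP.PneNP.Theses.WitnessForging.Assembly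
  intro hB hC hX
  exact Summit.PneNP.PneNP.Theses.WitnessForging.closes hX hB hC

end Summit.PneNP.PneNP.Theorems
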